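import Mathlib.Algebra.CubicDiscriminant
import Mathlib.Tactic
import HarnessLib

/-!
# K-T2 CORE — THE EXCEPTIONAL-FACE EXPANSION OF THE SLICE DISCRIMINANT: for `P = (x − φ)²(x − ψ) + e·G`, `Disc_x P = e·(4(ψ − φ)³·G(φ) + e·(…))` exactly
# (crux `FInjectiveMacaulayfication` stmt-ResolutionOfSingularities-15315, chain w45a; the algebraic core of res-L1-w45a-stub-2 g14ʼs test T2 «exceptional-face factorisation»
# (`T-O2O3-stub2.md` c02b6089ba8e88cb: «e | Disc ⇒ P|_{e=0} = (x−φ_e)²(x−ψ_e) …, D₁ = −4B³G₀ + e(B²G₁² + 18BG₁G₀ − 27G₀²) − 4e²G₁³») and of res-L1-w45a-tri-2 g23ʼs literal check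
# `O2O3-BREAKTEST-tri2.md` 1a0171e63bbb2316 §3 («(Disc_x(P)/(su))|_{s=u=0} == 4(ψ−φ)³·Ḡ₀» 6/6 ×3); companion of ✓p722715 `SliceGenusDiscOrder` (K-T1); idle-serve initiative of
# seat res-L1-w45a-stub-1 g17, identities found by its exact-rational engine `g17-kt1/poly.py`)

[OURS · L1 W4.5a] Support file (`--supports stmt-ResolutionOfSingularities-15315 --as helper`); theorems only; UNCONDITIONAL `ring` identities over any commutative ring and two ideal-membership
corollaries; no named fact; NOT a statement of any manuscript; nothing of the crux is proved (the DEGREE bookkeeping of T2 — transversal weights ≤ 5/7/8 against `p` — and the converse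
«`e ∣ Disc ⇒ P|_{e=0}` has a double root» stay memo-level [ELEM two engines]). AI-written (AI review is weaker than expert review).

THE IDENTITY. Write the monic cubic near a double-root configuration on the face `e = 0` in TAYLOR LETTERS at the double root: `P = (x − φ)²(x − φ + B) + e·(G₀ + G₁(x − φ) + G₂(x − φ)²)`
(`B = φ − ψ` the root separation on the face, `G₀ = G(φ)`). Then (§1 `discr_doubleRoot_deformation`, `ring`; `φ` drops out by translation invariance)
`Disc_x P = e·( −4B³G₀ + e·(B²G₁² + 18BG₀G₁ − 27G₀² − 12B²G₀G₂) + e²·(−4G₁³ + 18G₀G₁G₂ + 2BG₁²G₂ − 12BG₀G₂²) + e³·(G₁²G₂² − 4G₀G₂³) )`;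
with `G₂ = 0` this is res-L1-w45a-stub-2ʼs printed `D₁` VERBATIM (§1 `discr_doubleRoot_deformation_linear`), and in root letters `−4B³G₀ = 4(ψ − φ)³·G(φ)` is res-L1-w45a-tri-2ʼs checked
form (§1 `discr_doubleRoot_deformation_roots`). Consequences (§2, any commutative ring): `Disc_x P ∈ (e)` and ★ `Disc_x P − e·(−4B³G₀) ∈ (e²)` — the `e¹`-COEFFICIENT of the slice
discriminant along an exceptional face carrying a double root is `4(ψ−φ)³G(φ)`: the quantity whose weighted degree T2 bounds.
* §1 `discr_doubleRoot_deformation`, `discr_doubleRoot_deformation_linear`, `discr_doubleRoot_deformation_roots`; §2 `discr_mem_span_face`, ★ `discr_sub_linear_mem_span_face_sq`.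
[folklore computation]
-/

-- single-problem summit: the doubled namespace component is forced
set_option linter.dupNamespace false

namespace Summit.ResolutionOfSingularities.ResolutionOfSingularities.Theorems.FInjectiveMacaulayfication.SliceDiscExceptionalFace

variable {A : Type*} [CommRing A]

/-! ## §1 The expansion along the face -/

/-- **THE EXCEPTIONAL-FACE EXPANSION** (Taylor letters at the double root): the cubic `(x − φ)²(x − φ + B) + e(G₀ + G₁(x−φ) + G₂(x−φ)²)` has coefficients
`b = eG₂ − (3φ − B)`, `c = 3φ² − 2Bφ + e(G₁ − 2φG₂)`, `d = −φ²(φ − B) + e(G₀ − φG₁ + φ²G₂)`, and its discriminant is `e` times the displayed cubic polynomial in `e` — `φ`-free.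
[folklore computation; `ring`] -/
theorem discr_doubleRoot_deformation (φ B e G₀ G₁ G₂ : A) :
    Cubic.discr (⟨1, e * G₂ - (3 * φ - B), 3 * φ ^ 2 - 2 * B * φ + e * (G₁ - 2 * φ * G₂), -(φ ^ 2 * (φ - B)) + e * (G₀ - φ * G₁ + φ ^ 2 * G₂)⟩ : Cubic A) =
      e * (-(4 * B ^ 3 * G₀) + e * (B ^ 2 * G₁ ^ 2 + 18 * B * G₀ * G₁ - 27 * G₀ ^ 2 - 12 * B ^ 2 * G₀ * G₂)
        + e ^ 2 * (-(4 * G₁ ^ 3) + 18 * G₀ * G₁ * G₂ + 2 * B * G₁ ^ 2 * G₂ - 12 * B * G₀ * G₂ ^ 2) + e ^ 3 * (G₁ ^ 2 * G₂ ^ 2 - 4 * G₀ * G₂ ^ 3)) := by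
  simp only [Cubic.discr]
  ring

/-- The same with `G₂ = 0` (deformation linear in `x − φ`): `Disc = e·(−4B³G₀ + e(B²G₁² + 18BG₁G₀ − 27G₀²) − 4e²G₁³)` — res-L1-w45a-stub-2ʼs printed `D₁`. [folklore computation; `ring`] -/
theorem discr_doubleRoot_deformation_linear (φ B e G₀ G₁ : A) :
    Cubic.discr (⟨1, -(3 * φ - B), 3 * φ ^ 2 - 2 * B * φ + e * G₁, -(φ ^ 2 * (φ - B)) + e * (G₀ - φ * G₁)⟩ : Cubic A) =
      e * (-(4 * B ^ 3 * G₀) + e * (B ^ 2 * G₁ ^ 2 + 18 * B * G₁ * G₀ - 27 * G₀ ^ 2) - 4 * e ^ 2 * G₁ ^ 3) := by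
  simp only [Cubic.discr]
  ring

/-- ROOT LETTERS (`ψ = φ − B`, deformation `e·(g₂x² + g₁x + g₀)` in powers of `x`): the `e¹`-coefficient is `4(ψ − φ)³·(g₂φ² + g₁φ + g₀) = 4(ψ−φ)³·G(φ)` — res-L1-w45a-tri-2ʼs checked form —
i.e. `Disc − 4e(ψ−φ)³G(φ)` is `e²` times an explicit polynomial. [folklore computation; `ring`] -/
theorem discr_doubleRoot_deformation_roots (φ ψ e g₀ g₁ g₂ : A) :
    Cubic.discr (⟨1, -(2 * φ + ψ) + e * g₂, φ ^ 2 + 2 * φ * ψ + e * g₁, -(φ ^ 2 * ψ) + e * g₀⟩ : Cubic A) -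
        4 * e * (ψ - φ) ^ 3 * (g₂ * φ ^ 2 + g₁ * φ + g₀) =
      e ^ 2 * (((φ - ψ) ^ 2 * (g₁ + 2 * φ * g₂) ^ 2 + 18 * (φ - ψ) * (g₂ * φ ^ 2 + g₁ * φ + g₀) * (g₁ + 2 * φ * g₂)
          - 27 * (g₂ * φ ^ 2 + g₁ * φ + g₀) ^ 2 - 12 * (φ - ψ) ^ 2 * (g₂ * φ ^ 2 + g₁ * φ + g₀) * g₂)
        + e * (-(4 * (g₁ + 2 * φ * g₂) ^ 3) + 18 * (g₂ * φ ^ 2 + g₁ * φ + g₀) * (g₁ + 2 * φ * g₂) * g₂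
          + 2 * (φ - ψ) * (g₁ + 2 * φ * g₂) ^ 2 * g₂ - 12 * (φ - ψ) * (g₂ * φ ^ 2 + g₁ * φ + g₀) * g₂ ^ 2)
        + e ^ 2 * ((g₁ + 2 * φ * g₂) ^ 2 * g₂ ^ 2 - 4 * (g₂ * φ ^ 2 + g₁ * φ + g₀) * g₂ ^ 3)) := by
  simp only [Cubic.discr]
  ring

/-! ## §2 Consequences in ideal form -/

/-- The discriminant of a cubic with a double root on the face `e = 0` lies in `(e)`. [folklore computation] -/
theorem discr_mem_span_face (φ B e G₀ G₁ G₂ : A) :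
    Cubic.discr (⟨1, e * G₂ - (3 * φ - B), 3 * φ ^ 2 - 2 * B * φ + e * (G₁ - 2 * φ * G₂), -(φ ^ 2 * (φ - B)) + e * (G₀ - φ * G₁ + φ ^ 2 * G₂)⟩ : Cubic A) ∈
      Ideal.span ({e} : Set A) := by
  rw [discr_doubleRoot_deformation]
  exact Ideal.mul_mem_right _ _ (Ideal.mem_span_singleton_self e)

/-- ★ **THE `e¹`-COEFFICIENT ALONG THE FACE IS `−4B³G₀ = 4(ψ−φ)³G(φ)`**: `Disc_x P − e·(−4B³G₀) ∈ (e²)`. When the face letter divides the discriminant to order exactly `α_e`, this is the term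
T2 reads off («the `e^{α_e−1}`-coefficient is non-zero of weighted degree ≤ 5 / 7 / 8», memo-level). [OURS · K-T2 core; folklore computation] -/
theorem discr_sub_linear_mem_span_face_sq (φ B e G₀ G₁ G₂ : A) :
    Cubic.discr (⟨1, e * G₂ - (3 * φ - B), 3 * φ ^ 2 - 2 * B * φ + e * (G₁ - 2 * φ * G₂), -(φ ^ 2 * (φ - B)) + e * (G₀ - φ * G₁ + φ ^ 2 * G₂)⟩ : Cubic A) -
        e * (-(4 * B ^ 3 * G₀)) ∈ Ideal.span ({e ^ 2} : Set A) := by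
  rw [discr_doubleRoot_deformation, Ideal.mem_span_singleton]
  exact ⟨(B ^ 2 * G₁ ^ 2 + 18 * B * G₀ * G₁ - 27 * G₀ ^ 2 - 12 * B ^ 2 * G₀ * G₂)
      + e * (-(4 * G₁ ^ 3) + 18 * G₀ * G₁ * G₂ + 2 * B * G₁ ^ 2 * G₂ - 12 * B * G₀ * G₂ ^ 2) + e ^ 2 * (G₁ ^ 2 * G₂ ^ 2 - 4 * G₀ * G₂ ^ 3), by ring⟩

end Summit.ResolutionOfSingularities.ResolutionOfSingularities.Theorems.FInjectiveMacaulayfication.SliceDiscExceptionalFace
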